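import Summits.Schanuel.Schanuel.Theorems.ZilberEacSequenceRelation
import HarnessLib

/-!
# THEOREM H in every dimension: `k + 1` coordinates on a variety of dimension `≤ k + 1` whose
# exponential points are NOT Zariski dense satisfy a nonzero polynomial relation

Zilber's Exponential-Algebraic Closedness, case ladder (host summit Schanuel, cell `pub-schanuel`,
seat 2, gen 9).  `ZilberEacSequenceRelation` (THEOREM H) is the case `k = 1` (surfaces, two
coordinates, `H ∈ ℂ[s][t]`); the density theorems for `(s+2)`-folds in `EC(s+2, s+1)` — in
particular for the 3-folds of the open cell `EC(3,2)` — need the general case: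

* `exists_mvPolynomial_relation_of_trdeg_le` — in a `ℂ`-domain of transcendence degree `≤ k` any
  `k + 1` elements satisfy `H(u) = 0` for a nonzero `H ∈ ℂ[X₀, …, X_k]` (Mathlib:
  an algebraically independent family has cardinality `≤ trdeg`);
* `ringKrullDim_quotient_le_of_zariskiDim_le` — a prime `J ⊋ I(S)` over an irreducible closed `S`
  with `dim S ≤ k + 1` has `dim ℂ[X]/J ≤ k`;
* THEOREM H⁽ᵏ⁾ `exists_mvPolynomial_relation_of_vanishing` — `S ⊆ ℂⁿ × ℂⁿ` irreducible closed of
  dimension `≤ k + 1`, `P ⊆ S`, `f ∉ I(S)` vanishing on `P`: for ANY `k + 1` coordinates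
  `c₀, …, c_k` there is a nonzero `H ∈ ℂ[X₀, …, X_k]` with `H(p(c₀), …, p(c_k)) = 0` for all `p ∈ P`
  (components of `cl P` = minimal primes over `I(P)`, each of dimension `≤ k`; multiply the
  relations); the sequence form `exists_mvPolynomial_relation_of_forall_aeval_eq_zero`; and the
  density form `unprojectedDense_of_no_relation` (if for some `k + 1` coordinates NO nonzero `H`
  vanishes on all exponential points, they are Zariski dense).

HONEST FRAMING: structural lemma (commutative algebra: Krull dimension = transcendence degree for
affine domains, from the tree's `Literature.RingTheory.KrullDimension`); the analytic endgame for
3-folds is `ZilberEacDirectionalDominance`; `EC(3,2)` OPEN; nothing here bears on Schanuel's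
conjecture (EAC ⇏ SC).
-/

noncomputable section

open MvPolynomial Filter
open Literature.NumberTheory.Transcendental Literature.ModelTheory.Zilber

set_option linter.dupNamespace false

namespace Summit.Schanuel.Schanuel.Theorems

/-! ## Any `k + 1` elements of a domain of transcendence degree `≤ k` are algebraically dependent -/

section Algebra

variable {K : Type} [CommRing K] [Algebra ℂ K]

/-- In a `ℂ`-algebra of transcendence degree `≤ k`, any `k + 1` elements `u₀, …, u_k` satisfy
`H(u) = 0` for some nonzero `H ∈ ℂ[X₀, …, X_k]` (universe-`0` algebras suffice here: quotients of
`ℂ[X]`). [folklore] -/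
theorem exists_mvPolynomial_relation_of_trdeg_le {k : ℕ} (hk : Algebra.trdeg ℂ K ≤ k)
    (u : Fin (k + 1) → K) :
    ∃ H : MvPolynomial (Fin (k + 1)) ℂ, H ≠ 0 ∧ aeval u H = 0 := by
  by_contra hcon
  push Not at hcon
  have hind : AlgebraicIndependent ℂ u :=
    algebraicIndependent_iff.2 fun p hp => by
      by_contra h0
      exact hcon p h0 hp
  have h1 := hind.cardinalMk_le_trdeg
  rw [Cardinal.mk_fin] at h1
  have h2 : ((k + 1 : ℕ) : Cardinal) ≤ (k : Cardinal) := h1.trans hk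
  have h3 : k + 1 ≤ k := by exact_mod_cast h2
  omega

end Algebra

/-! ## Theorem H⁽ᵏ⁾: a `(k+1)`-variable relation on a Zariski-non-dense subset -/

section Relation

variable {n : ℕ}

/-- **Dimension step.**  A prime `J ⊋ I(S)` (witnessed by `f ∈ J ∖ I(S)`) over an irreducible closed
`S` of dimension `≤ k + 1` has `dim ℂ[X]/J ≤ k`. [folklore] -/
theorem ringKrullDim_quotient_le_of_zariskiDim_le {S : Set (Fin n ⊕ Fin n → ℂ)}
    (hS : IsIrreducibleClosed ℂ S) {k : ℕ} (hdim : zariskiDim ℂ S ≤ ((k + 1 : ℕ) : WithBot ℕ∞))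
    {J : Ideal (MvPolynomial (Fin n ⊕ Fin n) ℂ)} [J.IsPrime]
    (hIJ : vanishingIdeal ℂ S ≤ J) {f : MvPolynomial (Fin n ⊕ Fin n) ℂ} (hfJ : f ∈ J)
    (hf : f ∉ vanishingIdeal ℂ S) :
    ringKrullDim (MvPolynomial (Fin n ⊕ Fin n) ℂ ⧸ J) ≤ (k : ℕ) := by
  haveI : (vanishingIdeal ℂ S).IsPrime := hS.2
  haveI : IsDomain (MvPolynomial (Fin n ⊕ Fin n) ℂ ⧸ vanishingIdeal ℂ S) := Ideal.Quotient.isDomain _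
  have h𝔭ne : J.map (Ideal.Quotient.mk (vanishingIdeal ℂ S)) ≠ ⊥ := by
    intro h
    have : Ideal.Quotient.mk (vanishingIdeal ℂ S) f ∈ J.map (Ideal.Quotient.mk (vanishingIdeal ℂ S)) :=
      Ideal.mem_map_of_mem _ hfJ
    rw [h, Ideal.mem_bot, Ideal.Quotient.eq_zero_iff_mem] at this
    exact hf this
  have h1 := Literature.RingTheory.KrullDimension.ringKrullDim_quotient_add_one_le h𝔭ne
  rw [ringKrullDim_eq_of_ringEquiv (DoubleQuot.quotQuotEquivQuotOfLE hIJ)] at h1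
  have h3 : ringKrullDim (MvPolynomial (Fin n ⊕ Fin n) ℂ ⧸ vanishingIdeal ℂ S) ≤
      ((k + 1 : ℕ) : WithBot ℕ∞) := hdim
  exact withBot_enat_le_of_add_one_le (k := k) (h1.trans h3)

/-- **Transcendence step.**  Under the same hypotheses `trdeg_ℂ (ℂ[X]/J) ≤ k`. [folklore] -/
theorem trdeg_quotient_le_of_zariskiDim_le {S : Set (Fin n ⊕ Fin n → ℂ)}
    (hS : IsIrreducibleClosed ℂ S) {k : ℕ} (hdim : zariskiDim ℂ S ≤ ((k + 1 : ℕ) : WithBot ℕ∞))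
    {J : Ideal (MvPolynomial (Fin n ⊕ Fin n) ℂ)} [J.IsPrime]
    (hIJ : vanishingIdeal ℂ S ≤ J) {f : MvPolynomial (Fin n ⊕ Fin n) ℂ} (hfJ : f ∈ J)
    (hf : f ∉ vanishingIdeal ℂ S) :
    Algebra.trdeg ℂ (MvPolynomial (Fin n ⊕ Fin n) ℂ ⧸ J) ≤ k := by
  have hdimQ := ringKrullDim_quotient_le_of_zariskiDim_le hS hdim hIJ hfJ hf
  set R := MvPolynomial (Fin n ⊕ Fin n) ℂ ⧸ J
  haveI : IsDomain R := Ideal.Quotient.isDomain _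
  have h := Literature.RingTheory.KrullDimension.ringKrullDim_eq_trdeg ℂ R
  rw [h] at hdimQ
  have hnat : Cardinal.toNat (Algebra.trdeg ℂ R) ≤ k := by exact_mod_cast hdimQ
  rw [Literature.RingTheory.KrullDimension.trdeg_eq_toNat ℂ R]
  exact_mod_cast hnat

/-- **Evaluation at a point of `Z(J)`** of a relation `H(X_{c₀}, …, X_{c_k}) = 0` holding in
`ℂ[X]/J`. [folklore] -/
theorem mvPolynomial_aeval_eq_zero_of_mem_zeroLocus {J : Ideal (MvPolynomial (Fin n ⊕ Fin n) ℂ)}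
    {k : ℕ} (c : Fin (k + 1) → Fin n ⊕ Fin n) {H : MvPolynomial (Fin (k + 1)) ℂ}
    (hH : aeval (fun i => Ideal.Quotient.mk J (X (c i) : MvPolynomial (Fin n ⊕ Fin n) ℂ)) H = 0)
    {q : Fin n ⊕ Fin n → ℂ} (hq : q ∈ zeroLocus ℂ J) :
    aeval (fun i => q (c i)) H = 0 := by
  have hkill : ∀ g ∈ J, aeval q g = 0 := (mem_zeroLocus_iff.1 hq)
  let ψ : (MvPolynomial (Fin n ⊕ Fin n) ℂ ⧸ J) →ₐ[ℂ] ℂ := Ideal.Quotient.liftₐ J (aeval q) hkill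
  have hψX : ∀ j, ψ (Ideal.Quotient.mk J (X j)) = q j := fun j => by
    change Ideal.Quotient.liftₐ J (aeval q) hkill (Ideal.Quotient.mk J (X j)) = q j
    rw [Ideal.Quotient.liftₐ_apply, Ideal.Quotient.lift_mk, RingHom.coe_coe, MvPolynomial.aeval_X]
  have h := congrArg ψ hH
  rw [map_zero, ← AlgHom.comp_apply, MvPolynomial.comp_aeval] at h
  have hfun : (fun i => ψ (Ideal.Quotient.mk J (X (c i)))) = fun i => q (c i) := by
    funext i; exact hψX (c i)
  rwa [hfun] at h

/-- **Theorem H⁽ᵏ⁾ (`(k+1)`-variable relation on a Zariski-non-dense subset).**  Let `S` be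
irreducible closed with `dim S ≤ k + 1`, `P ⊆ S`, and `f ∉ I(S)` with `f(p) = 0` for all `p ∈ P`.
Then for any coordinates `c₀, …, c_k` some nonzero `H ∈ ℂ[X₀, …, X_k]` has
`H(p(c₀), …, p(c_k)) = 0` for ALL `p ∈ P`. [folklore] -/
theorem exists_mvPolynomial_relation_of_vanishing {S : Set (Fin n ⊕ Fin n → ℂ)}
    (hS : IsIrreducibleClosed ℂ S) {k : ℕ} (hdim : zariskiDim ℂ S ≤ ((k + 1 : ℕ) : WithBot ℕ∞))
    {P : Set (Fin n ⊕ Fin n → ℂ)} (hPS : P ⊆ S) {f : MvPolynomial (Fin n ⊕ Fin n) ℂ}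
    (hf : f ∉ vanishingIdeal ℂ S) (hfP : ∀ p ∈ P, aeval p f = 0)
    (c : Fin (k + 1) → Fin n ⊕ Fin n) :
    ∃ H : MvPolynomial (Fin (k + 1)) ℂ, H ≠ 0 ∧ ∀ p ∈ P, eval (fun i => p (c i)) H = 0 := by
  classical
  set I := vanishingIdeal ℂ P with hI
  have hIS : vanishingIdeal ℂ S ≤ I := vanishingIdeal_anti_mono hPS
  have hfI : f ∈ I := by rw [hI, mem_vanishingIdeal_iff]; exact hfP
  have hpI : ∀ p ∈ P, p ∈ zeroLocus ℂ I := fun p hp =>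
    (mem_zeroLocus_iff).2 fun g hg => (mem_vanishingIdeal_iff.1 hg) _ hp
  -- a relation on each component
  have hcomp : ∀ Q : Ideal (MvPolynomial (Fin n ⊕ Fin n) ℂ), Q ∈ I.minimalPrimes →
      ∃ H : MvPolynomial (Fin (k + 1)) ℂ, H ≠ 0 ∧
        aeval (fun i => Ideal.Quotient.mk Q (X (c i) : MvPolynomial (Fin n ⊕ Fin n) ℂ)) H = 0 := by
    intro Q hQ
    haveI : Q.IsPrime := hQ.1.1
    have hIQ : I ≤ Q := hQ.1.2
    haveI : IsDomain (MvPolynomial (Fin n ⊕ Fin n) ℂ ⧸ Q) := Ideal.Quotient.isDomain _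
    exact exists_mvPolynomial_relation_of_trdeg_le
      (trdeg_quotient_le_of_zariskiDim_le hS hdim (hIS.trans hIQ) (hIQ hfI) hf) _
  choose! Hc hHc0 hHc using hcomp
  have hfin := Ideal.finite_minimalPrimes_of_isNoetherianRing (MvPolynomial (Fin n ⊕ Fin n) ℂ) I
  refine ⟨∏ Q ∈ hfin.toFinset, Hc Q, ?_, fun p hp => ?_⟩
  · exact Finset.prod_ne_zero_iff.2 fun Q hQ => hHc0 Q (hfin.mem_toFinset.1 hQ)
  · obtain ⟨Q, hQ, hmQ⟩ := exists_minimalPrime_mem_zeroLocus (hpI p hp)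
    rw [map_prod]
    refine Finset.prod_eq_zero (hfin.mem_toFinset.2 hQ) ?_
    exact mvPolynomial_aeval_eq_zero_of_mem_zeroLocus c (hHc Q hQ) hmQ

/-- **Theorem H⁽ᵏ⁾, sequence form.**  `S` irreducible closed with `dim S ≤ k + 1`, `p₀, p₁, … ∈ S`,
`f ∉ I(S)` with `f(p_m) = 0` for all `m`: for any coordinates `c₀, …, c_k` some nonzero
`H ∈ ℂ[X₀, …, X_k]` has `H(p_m(c₀), …, p_m(c_k)) = 0` for ALL `m`. [folklore] -/
theorem exists_mvPolynomial_relation_of_forall_aeval_eq_zero {S : Set (Fin n ⊕ Fin n → ℂ)}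
    (hS : IsIrreducibleClosed ℂ S) {k : ℕ} (hdim : zariskiDim ℂ S ≤ ((k + 1 : ℕ) : WithBot ℕ∞))
    {p : ℕ → Fin n ⊕ Fin n → ℂ} (hpS : ∀ m, p m ∈ S) {f : MvPolynomial (Fin n ⊕ Fin n) ℂ}
    (hf : f ∉ vanishingIdeal ℂ S) (hfp : ∀ m, aeval (p m) f = 0)
    (c : Fin (k + 1) → Fin n ⊕ Fin n) :
    ∃ H : MvPolynomial (Fin (k + 1)) ℂ, H ≠ 0 ∧ ∀ m, eval (fun i => p m (c i)) H = 0 := by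
  obtain ⟨H, hH0, hH⟩ := exists_mvPolynomial_relation_of_vanishing hS hdim (P := Set.range p)
    (by rintro _ ⟨m, rfl⟩; exact hpS m) hf (by rintro _ ⟨m, rfl⟩; exact hfp m) c
  exact ⟨H, hH0, fun m => hH _ ⟨m, rfl⟩⟩

/-- **Density form.**  If `S` is irreducible closed of dimension `≤ k + 1` and for some
`k + 1` coordinates `c` NO nonzero `H ∈ ℂ[X₀, …, X_k]` vanishes at `(p(c₀), …, p(c_k))` for every
exponential point `p ∈ S ∩ Γ_exp`, then the exponential points are Zariski dense in `S`
(`I(S ∩ Γ_exp) = I(S)`). [folklore] -/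
theorem unprojectedDense_of_no_relation {S : Set (Fin n ⊕ Fin n → ℂ)}
    (hS : IsIrreducibleClosed ℂ S) {k : ℕ} (hdim : zariskiDim ℂ S ≤ ((k + 1 : ℕ) : WithBot ℕ∞))
    (c : Fin (k + 1) → Fin n ⊕ Fin n)
    (hno : ∀ H : MvPolynomial (Fin (k + 1)) ℂ, H ≠ 0 →
      ∃ p ∈ S ∩ expGraph ℂ n, eval (fun i => p (c i)) H ≠ 0) :
    UnprojectedDense S := by
  refine le_antisymm ?_ (vanishingIdeal_anti_mono Set.inter_subset_left)
  intro f hf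
  by_contra hfS
  obtain ⟨H, hH0, hH⟩ := exists_mvPolynomial_relation_of_vanishing hS hdim
    (P := S ∩ expGraph ℂ n) Set.inter_subset_left hfS
    (fun p hp => (mem_vanishingIdeal_iff.1 hf) _ hp) c
  obtain ⟨p, hp, hne⟩ := hno H hH0
  exact hne (hH p hp)

end Relation

end Summit.Schanuel.Schanuel.Theorems

end
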